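/-
Copyright: the b2b-balaban T⁴-continuum CRUX team, row NE7b leaf lineage `t4-ne7b-formalise-leaf-04` (gen 151). Project licence.
-/
import Summits.QuantumFields.BalabanUV.T4Continuum.Spine.NE7b.MoreauEnvelopeLetters
import Summits.QuantumFields.BalabanUV.T4Continuum.Spine.NE7b.SoftConstraintEnvelope

/-!
# THE LETTERS OF THE SOFT AVERAGING STEP FROM `S`'s CONVEXITY ALONE: `ψ(x) = min_y [S y + a‖x − P y‖²]` is `C¹` with
# `∇ψ(x) = 2a(x − prox_{φ∕(2a)} x)`, `∇ψ` is `2a`-Lipschitz, growth constant `a`, and for `σ`-strongly convex `S` with `‖P y‖ ≤ κ‖y‖`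
# modulus `2aσ∕(σ + 2aκ²)` — `…MoreauEnvelopeLetters` (MEL) ∘ `…SoftConstraintEnvelope` (SCE), the junction certificate SCE's header owes
# (row NE7b, node U5c; residual (R2′) family (2), letters (ℓ1)∕(ℓ2) through a CLASSICAL soft step; [folklore] junction)

Cell `pub-balaban`, sub-cell `t4`, spine estimate NE7b (`T4WeightBudget.RelWeightBound`; NOT PRINTED in [Bałaban 1983–89], NOT PROVED).  Crux-route
work under `Spine/NE7b/` by leaf-04; NOTHING of Bałaban's is named or asserted; no `def`; zero `sorry`.  Imports: MEL (p378204 ✓) and SCE (this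
lineage) — both without hub oleans at writing, hence certified by source concatenation and filed into the retry lane.

WHAT IS PROVED ([folklore] junction; `S : E → ℝ` convex on `univ` and bounded below, `P : E →ₗ[ℝ] F` onto, `F` a finite-dimensional real inner
product space, `0 < a`, `f := φ∕(2a)` with `φ z = ⨅_{P y = z} S y` written out):
* `softValue_eq_fun` (`ψ = 2a · e_f` as functions — SCE §4 under `funext`);
* **`hasGradientAt_softValue`** (`HasGradientAt ψ (2a • (x − prox f x)) x` at EVERY `x` — MEL's Moreau theorem, scaled);
* `lipschitzWith_gradSoftValue` (`x ↦ 2a • (x − prox f x)` is `‖2a‖₊`-Lipschitz — MEL §4);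
* **`softValue_growth`** (`ψ x′ ≤ ψ x + ⟪2a•(x − prox f x), x′ − x⟫ + a‖x′ − x‖²` — MEL §5's constant `½`, scaled: growth = the weight);
* **`softValue_firstOrder_of_strongConvexOn`** (`S` `σ`-strongly convex, `0 ≤ σ`, `‖P y‖ ≤ κ‖y‖`, `0 < κ`:
  `ψ x + ⟪2a•(x − prox f x), x′ − x⟫ + (2aσ∕(σ + 2aκ²))∕2 · ‖x′ − x‖² ≤ ψ x′` — MEL §5 with `m = σ∕(2aκ²)` (SCE §3) and SCE's `modulus_bookkeeping`).

NOT HERE (honest): `StrongConvexOn univ (2aσ∕(σ+2aκ²)) ψ` in secant currency (two more lines from the last theorem, as MEL §5 does); windows;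
which `S, P, a` of Bałaban's ((A3) ∕ (A1c), NC-NE7b-α UNRULED); anything of Bałaban's.  BY-NAME EFFECT ON THE WALL: NONE.  NE7b NOT PRINTED ∕ NOT
PROVED; spine PROVED 0∕9; rung (B)+1 on a FINITE torus — NOT infinite volume, NOT the mass gap, NOT Clay.  HONEST DEPENDENCY: continuum YM on T⁴ ⇐
BetaPertH ∧ nine spine estimates (0/9 proved); BetaPertH ⇐ (D1) ∧ (D4) ∧ CAP+tail; G-an2-4 gates asym, D1 and NE2∕3∕4.
-/

set_option autoImplicit false

noncomputable section

namespace Summit.QuantumFields.BalabanUV.T4Continuum.NE7b.SoftConstraintEnvelopeLetters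

open Set Function InnerProductSpace
open scoped RealInnerProductSpace NNReal
open Literature.Analysis.Convex
open Summit.QuantumFields.BalabanUV.T4Continuum.NE7b.MoreauEnvelopeLetters
open Summit.QuantumFields.BalabanUV.T4Continuum.NE7b.SoftConstraintEnvelope

variable {E F : Type*} [NormedAddCommGroup E] [NormedSpace ℝ E] [NormedAddCommGroup F] [InnerProductSpace ℝ F]
  [FiniteDimensional ℝ F]

/-- `ψ = 2a · e_{φ∕(2a)}` as functions of the kept variable. [folklore] -/
theorem softValue_eq_fun {S : E → ℝ} (hSc : ConvexOn ℝ univ S) (hS : BddBelow (range S)) (P : E →ₗ[ℝ] F) (hP : Surjective P)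
    {a : ℝ} (ha : 0 < a) :
    (fun x => ⨅ y, (S y + a * ‖x - P y‖ ^ 2))
      = fun x => 2 * a * proxFun (fun w => (⨅ y : {y // P y = w}, S y.1) / (2 * a)) x
          (prox (fun w => (⨅ y : {y // P y = w}, S y.1) / (2 * a)) x) :=
  funext fun x => softValue_eq_mul_proxEnv_of_convexOn hSc hS P hP ha x

/-- **THE SOFT VALUE IS `C¹` WITH GRADIENT `2a(x − prox_{φ∕(2a)} x)`** — for ANY convex `S` bounded below and ANY linear onto `P` (Moreau's
theorem, MEL §3, scaled by `2a` through SCE §4). [folklore] -/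
theorem hasGradientAt_softValue {S : E → ℝ} (hSc : ConvexOn ℝ univ S) (hS : BddBelow (range S)) (P : E →ₗ[ℝ] F) (hP : Surjective P)
    {a : ℝ} (ha : 0 < a) (x : F) :
    HasGradientAt (fun x => ⨅ y, (S y + a * ‖x - P y‖ ^ 2))
      ((2 * a) • (x - prox (fun w => (⨅ y : {y // P y = w}, S y.1) / (2 * a)) x)) x := by
  set f : F → ℝ := fun w => (⨅ y : {y // P y = w}, S y.1) / (2 * a) with hf
  have hφ : ConvexOn ℝ univ f := convexOn_div_const (convexOn_hardValue hSc hS P hP) (by positivity)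
  rw [softValue_eq_fun hSc hS P hP ha, hasGradientAt_iff_hasFDerivAt]
  have h := (hasFDerivAt_proxEnv hφ x).const_mul (2 * a)
  have e : (2 * a) • (toDual ℝ F) (x - prox f x) = (toDual ℝ F) ((2 * a) • (x - prox f x)) := by rw [map_smul]
  rw [e] at h
  exact h

/-- The gradient field `x ↦ 2a(x − prox_{φ∕(2a)} x)` is `2a`-Lipschitz (MEL §4's firm non-expansiveness, scaled). [folklore] -/
theorem lipschitzWith_gradSoftValue {S : E → ℝ} (hSc : ConvexOn ℝ univ S) (hS : BddBelow (range S)) (P : E →ₗ[ℝ] F)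
    (hP : Surjective P) {a : ℝ} (ha : 0 < a) :
    LipschitzWith (‖2 * a‖₊ * 1) (fun x : F => (2 * a) • (x - prox (fun w => (⨅ y : {y // P y = w}, S y.1) / (2 * a)) x)) :=
  (lipschitzWith_smul (2 * a)).comp
    (lipschitzWith_gradEnv (convexOn_div_const (convexOn_hardValue hSc hS P hP) (by positivity)))

/-- **THE GROWTH LETTER OF THE SOFT STEP: constant `a`, the weight's, for EVERY convex `S`** (MEL §5's `½`, scaled). [folklore] -/
theorem softValue_growth {S : E → ℝ} (hSc : ConvexOn ℝ univ S) (hS : BddBelow (range S)) (P : E →ₗ[ℝ] F) (hP : Surjective P)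
    {a : ℝ} (ha : 0 < a) (x x' : F) :
    (⨅ y, (S y + a * ‖x' - P y‖ ^ 2))
      ≤ (⨅ y, (S y + a * ‖x - P y‖ ^ 2))
        + ⟪(2 * a) • (x - prox (fun w => (⨅ y : {y // P y = w}, S y.1) / (2 * a)) x), x' - x⟫ + a * ‖x' - x‖ ^ 2 := by
  set f : F → ℝ := fun w => (⨅ y : {y // P y = w}, S y.1) / (2 * a) with hf
  have hφ : ConvexOn ℝ univ f := convexOn_div_const (convexOn_hardValue hSc hS P hP) (by positivity)
  rw [softValue_eq_mul_proxEnv_of_convexOn hSc hS P hP ha x, softValue_eq_mul_proxEnv_of_convexOn hSc hS P hP ha x',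
    real_inner_smul_left]
  have h := proxEnv_growth hφ x x'
  have h2 := mul_le_mul_of_nonneg_left h (show (0 : ℝ) ≤ 2 * a by positivity)
  have e : 2 * a * (proxFun f x (prox f x) + ⟪x - prox f x, x' - x⟫ + 1 / 2 * ‖x' - x‖ ^ 2)
      = 2 * a * proxFun f x (prox f x) + 2 * a * ⟪x - prox f x, x' - x⟫ + a * ‖x' - x‖ ^ 2 := by ring
  linarith

/-- **THE FIRST-ORDER (MODULUS) LETTER OF THE SOFT STEP: `2aσ∕(σ + 2aκ²)`** — `S` `σ`-strongly convex (`0 ≤ σ`) and bounded below,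
`‖P y‖ ≤ κ‖y‖` (`0 < κ`): `ψ x + ⟪2a•(x − prox f x), x′ − x⟫ + (2aσ∕(σ + 2aκ²))∕2 · ‖x′ − x‖² ≤ ψ x′` (MEL §5 with `m = σ∕(2aκ²)` from
SCE §3, SCE's `modulus_bookkeeping`) — the OWNER's (30) modulus for the `2a`-convex weight, in first-order currency with the honest gradient.
[folklore] -/
theorem softValue_firstOrder_of_strongConvexOn {S : E → ℝ} {σ : ℝ} (hSc : StrongConvexOn univ σ S) (hσ : 0 ≤ σ)
    (hS : BddBelow (range S)) (P : E →ₗ[ℝ] F) (hP : Surjective P) {κ : ℝ} (hκ : 0 < κ) (hPκ : ∀ y, ‖P y‖ ≤ κ * ‖y‖)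
    {a : ℝ} (ha : 0 < a) (x x' : F) :
    (⨅ y, (S y + a * ‖x - P y‖ ^ 2))
        + ⟪(2 * a) • (x - prox (fun w => (⨅ y : {y // P y = w}, S y.1) / (2 * a)) x), x' - x⟫
        + (2 * a * σ / (σ + 2 * a * κ ^ 2)) / 2 * ‖x' - x‖ ^ 2
      ≤ ⨅ y, (S y + a * ‖x' - P y‖ ^ 2) := by
  set f : F → ℝ := fun w => (⨅ y : {y // P y = w}, S y.1) / (2 * a) with hf
  have hSconv : ConvexOn ℝ univ S := hSc.convexOn fun r => by positivity
  have hm : StrongConvexOn univ (σ / (2 * a * κ ^ 2)) f := strongConvexOn_hardValue_div hSc hσ hS P hP hκ hPκ ha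
  have hm0 : 0 ≤ σ / (2 * a * κ ^ 2) := by positivity
  rw [softValue_eq_mul_proxEnv_of_convexOn hSconv hS P hP ha x, softValue_eq_mul_proxEnv_of_convexOn hSconv hS P hP ha x',
    real_inner_smul_left, ← modulus_bookkeeping hσ hκ ha]
  have h := proxEnv_firstOrder_of_strongConvexOn hm hm0 x x'
  have h2 := mul_le_mul_of_nonneg_left h (show (0 : ℝ) ≤ 2 * a by positivity)
  have e : 2 * a * (proxFun f x (prox f x) + ⟪x - prox f x, x' - x⟫
        + σ / (2 * a * κ ^ 2) / (1 + σ / (2 * a * κ ^ 2)) / 2 * ‖x' - x‖ ^ 2)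
      = 2 * a * proxFun f x (prox f x) + 2 * a * ⟪x - prox f x, x' - x⟫
        + 2 * a * (σ / (2 * a * κ ^ 2) / (1 + σ / (2 * a * κ ^ 2))) / 2 * ‖x' - x‖ ^ 2 := by ring
  linarith

end Summit.QuantumFields.BalabanUV.T4Continuum.NE7b.SoftConstraintEnvelopeLetters

end
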